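import Summits.QuantumFields.YangMills.Theorems.BalabanUVNodesN15KingModelCovariantRandomWalk
import HarnessLib
/-!
# BalabanUVNodes ∕ N15 — THE KING-MODEL RUNG (PART Ϛ-a): THE COVARIANT FINE OPERATOR AT A TWO-SIDED COMPLEX LINK FIELD `M_{U,V} = D₀ − T_{U,V}` — the holomorphic
# family through PART Ͱ's `−cΔ_U + m²` (`V = Uᴴ`) and print's `Gᶜ`-extension (`V = U⁻¹`); blocks, stencil, adjoint, linearity, the `D₀`-factorisation and telescoping
# (Track A, DAG node N15 = NE2; FAN-OUT v1.1 §N15 s3 «KING-MODEL RUNG … + what the curved case adds»; count-neutral)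
HONEST FRAMING.  Count-neutral (cell `pub-ymgap`, seat `pub-ymgap-dag-n15-e` g43; `--supports stmt-QuantumFields-27247 --as helper` = K3ᴬ, KEY MAP v3).  One finite torus at fixed
spacing; King's `A = 0` model, FINE covariance layer only (PART Ͱ-j: King's full `G_k(U)` is not Kato-dominated); nothing of Bałaban's (3.42) ∕ Thm 3.4 for `G(U)` asserted; nothing
continuum ∕ ℝ⁴ ∕ OS ∕ Clay; NOT a node discharge (N15 of record untouched).
THE OBJECT.  [Balaban1985BackgroundPropagators] §3.B p.399 l.37–40: «The operators introduced in the previous section depend on a gauge field configuration U with values in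
the Lie group G. We would like to prove that this dependence is analytic. The simplest way to do it is to extend the operators to configurations with values in the complexified
group Gᶜ and to prove the usual complex analyticity.»; Thm 3.4 p.400: the propagators «extend to configurations U′U … as analytic functions of A. The extended operators satisfy
all the inequalities of Theorems 3.1–3.3 correspondingly.»  In King's `A = 0` model (PART Ͱ-a: `M_U = −cΔ_U + m²` on `v : Π_μℤ∕K_μ → 𝕜ⁿ`, forward transporter `U(x,μ)` on
`x → x+e_μ`, backward transporter `U(x,μ)^*`) the complexification replaces the backward transporter `U(x,μ)^*` by an INDEPENDENT link variable `V(x,μ)`: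
`(M_{U,V}v)(x) = (m² + 2(d+1)c)v(x) − cΣ_μ(U(x,μ)v(x+e_μ) + V(x−e_μ,μ)v(x−e_μ))` — a family that is complex-linear (hence holomorphic) in the pair `(U,V)`, equal to PART Ͱ's
Hermitian `M_U` on the slice `V = Uᴴ` (ANY `U`), and to print's `Gᶜ`-valued extension on the slice `V = U⁻¹` (which meets `V = Uᴴ` exactly on the unitary fields).
PROVED HERE (bookkeeping for PART Ϛ): §1 defs **`cxHop K c U V`** (`T_{U,V} = cΣ_b(E_{b₋b₊}(U_b) + E_{b₊b₋}(V_b))`), **`cxLapF K c m² U V = D₀·1 − T_{U,V}`**; ★ `cxHop_adjoint` (`T_{U,Uᴴ}` = the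
tree's `Hopping.hop U` of the King datum, `rfl`), ★★ **`cxLapF_adjoint`** (`M_{U,Uᴴ} = covLapF K c m² U`, every `U`), ★ **`cxLapF_inv_of_unitary`** (`M_{U,U⁻¹} = M_U` for unitary `U`:
print's extension through the unitary slice), `cxLapF_free`; `cxHop_conjTranspose` (`T_{U,V}ᴴ = T_{Vᴴ,Uᴴ}`), `cxLapF_conjTranspose`; linearity `cxHop_add`∕`_sub`∕`_smul`∕`_zero`,
`cxLapF_sub_cxLapF` (`M_{U,V} − M_{U′,V′} = T_{U′,V′} − T_{U,V}`: the site weights cancel); §2 `blk_add'`∕`blk_smul'`∕`blk_sum'`∕`blk_placed'` (public twins of the tree's private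
block lemmas), ★★ **`blk_cxHop`** (`(T_{U,V})_{xy} = cΣ_μ([y = x+e_μ]U(x,μ) + [y = x−e_μ]V(x−e_μ,μ))`), `blk_cxLapF`, ★★ **`cxLapF_mulVec_apply`** (THE STENCIL above); §3 `cxLapF_eq_smul`
(`M = D₀(1 − D₀⁻¹T)`), ★ **`cxLapF_mul_partialSum`** ∕ ★ **`partialSum_mul_cxLapF`** (`M·Σ_{k<N}D₀^{−(k+1)}T^k = Σ_{k<N}D₀^{−(k+1)}T^k·M = 1 − (D₀⁻¹T)^N`, both sides — the two-sided
inverse of PART Ϛ-b comes from these).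
PRIOR TREE ART (by name): Ͱ-a (`kingHopping`, `covLapF`, `covLapF_eq`, `placed_mulVec_apply`), Ͱ-g (`blk_sub'`), Ͱ-l (`blk_one'`), `LatticeDiamagneticInequality` (`Hopping.hop`, `blk`,
`placed`, `Hopping.free`), Mathlib (`mul_neg_geom_sum`, `geom_sum_mul_neg`, `Matrix.mem_unitaryGroup_iff`).  Dedup (rg at filing): basename 0 files; needles `cxHop|cxLapF|blk_placed'|blk_sum'`
0 tree files.  Locators: [Balaban1985BackgroundPropagators] §3.B p.399 l.37–40, Thm 3.4 p.400, (3.23) p.394, (3.50)–(3.53) p.400; [King1986] (4.4) p.670.  0 `sorry`.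
-/

noncomputable section
open scoped BigOperators ComplexConjugate
open Finset Matrix

namespace Summit.QuantumFields.YangMills.BalabanUVNodes.N15KingModelRung.Covariant

open Literature.MathematicalPhysics.QuantumFieldTheory.LatticeDiamagneticInequality (Hopping blk placed)
open Literature.MathematicalPhysics.QuantumFieldTheory.Balaban1983to89.B5Prop11Plancherel (Tor unitVec)
open Literature.MathematicalPhysics.QuantumFieldTheory.King1986.Torus (lapF)

variable {d : ℕ} (K : Fin (d + 1) → ℕ) [hK : ∀ μ, NeZero (K μ)]
variable {𝕜 : Type*} [RCLike 𝕜] {n : Type*}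

/-! ## §1 The two-sided hopping matrix and the complexified operator -/

/-- THE TWO-SIDED HOPPING MATRIX `T_{U,V} = c·Σ_{b=(x,μ)}(E_{x,x+e_μ}(U(x,μ)) + E_{x+e_μ,x}(V(x,μ)))`: forward transporter `U(b)` on `x → x+e_μ`, backward transporter `V(b)` on
`x+e_μ → x` (print's complexified link field has `V(b) = U(b)⁻¹`; PART Ͱ's Hermitian family has `V(b) = U(b)^*`).
[cite: Balaban1985BackgroundPropagators, §3.B p.399 l.37–40, (3.50) p.400; King1986, (4.4) p.670] -/
def cxHop (c : ℝ) (U V : Tor K × Fin (d + 1) → Matrix n n 𝕜) : Matrix (Tor K × n) (Tor K × n) 𝕜 :=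
  ∑ b, (c : 𝕜) • (placed b.1 (b.1 + unitVec K b.2) (U b) + placed (b.1 + unitVec K b.2) b.1 (V b))

/-- THE COVARIANT FINE OPERATOR AT A TWO-SIDED COMPLEX LINK FIELD: `M_{U,V} = (m² + 2(d+1)c)·1 − T_{U,V}`, i.e.
`(M_{U,V}v)(x) = (m²+2(d+1)c)v(x) − cΣ_μ(U(x,μ)v(x+e_μ) + V(x−e_μ,μ)v(x−e_μ))` — the complex-linear family through `−cΔ_U + m²`.
[cite: Balaban1985BackgroundPropagators, Thm 3.4 p.400, (3.23) p.394; King1986, (4.4) p.670] -/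
def cxLapF [DecidableEq n] (c m2 : ℝ) (U V : Tor K × Fin (d + 1) → Matrix n n 𝕜) : Matrix (Tor K × n) (Tor K × n) 𝕜 :=
  diagonal (fun _ : Tor K × n => ((m2 + 2 * ((d : ℝ) + 1) * c : ℝ) : 𝕜)) - cxHop K c U V

variable [Fintype n] [DecidableEq n]

omit [Fintype n] [DecidableEq n] in
/-- ★ ON THE ADJOINT SLICE the two-sided hopping matrix is the tree's hopping matrix of the King datum: `T_{U,Uᴴ} = T_U` (definitional). [cite: Balaban1985BackgroundPropagators, (3.23) p.394] -/
theorem cxHop_adjoint (c m2 : ℝ) (U : Tor K × Fin (d + 1) → Matrix n n 𝕜) :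
    cxHop K c U (fun b => (U b)ᴴ) = (kingHopping K c m2).hop U := rfl

omit [Fintype n] in
/-- ★★ **ON THE ADJOINT SLICE `V = Uᴴ` THE FAMILY IS PART Ͱ's HERMITIAN OPERATOR**: `M_{U,Uᴴ} = −cΔ_U + m² = covLapF K c m² U`, for EVERY link field `U` (unitary or not).
[cite: Balaban1985BackgroundPropagators, (3.23) p.394, §3.B p.399 l.37–40] -/
theorem cxLapF_adjoint (c m2 : ℝ) (U : Tor K × Fin (d + 1) → Matrix n n 𝕜) :
    cxLapF K c m2 U (fun b => (U b)ᴴ) = covLapF K c m2 U := by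
  rw [covLapF_eq, cxLapF, cxHop_adjoint]

/-- ★ **PRINT's `Gᶜ`-EXTENSION THROUGH THE UNITARY SLICE**: for a unitary link field `U`, `M_{U,U⁻¹} = −cΔ_U + m²` (`U(b)⁻¹ = U(b)^*`), so the holomorphic family `U ↦ M_{U,U⁻¹}`
of [B9] §3.B extends PART Ͱ's operator off the unitary fields. [cite: Balaban1985BackgroundPropagators, §3.B p.399 l.37–40, Thm 3.4 p.400] -/
theorem cxLapF_inv_of_unitary (c m2 : ℝ) {U : Tor K × Fin (d + 1) → Matrix n n 𝕜} (hU : ∀ b, U b ∈ Matrix.unitaryGroup n 𝕜) :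
    cxLapF K c m2 U (fun b => (U b)⁻¹) = covLapF K c m2 U := by
  have h : (fun b => (U b)⁻¹) = fun b => (U b)ᴴ := by
    funext b
    have h1 : (U b)ᴴ * U b = 1 := by simpa only [star_eq_conjTranspose] using Matrix.mem_unitaryGroup_iff'.mp (hU b)
    exact Matrix.inv_eq_left_inv h1
  rw [h, cxLapF_adjoint]

omit [Fintype n] in
/-- At the free field the two-sided operator is PART Ͱ's free operator (`= lapF ⊗ₖ 1` by Ͱ-a `covLapF_free_eq_kronecker`). [cite: King1986, (4.4) p.670] -/
theorem cxLapF_free (c m2 : ℝ) :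
    cxLapF K c m2 (Hopping.free : Tor K × Fin (d + 1) → Matrix n n 𝕜) Hopping.free = covLapF K c m2 Hopping.free := by
  have h : (fun b => ((Hopping.free : Tor K × Fin (d + 1) → Matrix n n 𝕜) b)ᴴ) = Hopping.free := by
    funext b; simp [Hopping.free]
  rw [← cxLapF_adjoint, h]

omit hK [Fintype n] [DecidableEq n] in
/-- Public twin of the tree's private `conjTranspose_placed`: `(E_{xy}(A))ᴴ = E_{yx}(Aᴴ)`. [folklore] -/
theorem conjTranspose_placed' (x y : Tor K) (A : Matrix n n 𝕜) : (placed x y A)ᴴ = placed y x Aᴴ := by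
  ext p q
  simp only [placed, conjTranspose_apply, Matrix.of_apply]
  by_cases h : x = q.1 ∧ y = p.1
  · rw [if_pos h, if_pos ⟨h.2, h.1⟩]
  · have h' : ¬ (y = p.1 ∧ x = q.1) := fun h'' => h ⟨h''.2, h''.1⟩
    rw [if_neg h, if_neg h', star_zero]

omit [Fintype n] [DecidableEq n] in
/-- THE ADJOINT OF THE TWO-SIDED HOPPING MATRIX swaps and stars the transporters: `T_{U,V}ᴴ = T_{Vᴴ,Uᴴ}`. [folklore] -/
theorem cxHop_conjTranspose (c : ℝ) (U V : Tor K × Fin (d + 1) → Matrix n n 𝕜) :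
    (cxHop K c U V)ᴴ = cxHop K c (fun b => (V b)ᴴ) (fun b => (U b)ᴴ) := by
  unfold cxHop
  rw [conjTranspose_sum]
  refine Finset.sum_congr rfl fun b _ => ?_
  rw [conjTranspose_smul, conjTranspose_add, conjTranspose_placed', conjTranspose_placed', RCLike.star_def, RCLike.conj_ofReal]
  exact congrArg _ (add_comm _ _)

omit [Fintype n] in
/-- `M_{U,V}ᴴ = M_{Vᴴ,Uᴴ}`; in particular `M_{U,V}` is Hermitian on the adjoint slice (Ͱ-a `isHermitian_covLapF`). [folklore] -/
theorem cxLapF_conjTranspose (c m2 : ℝ) (U V : Tor K × Fin (d + 1) → Matrix n n 𝕜) :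
    (cxLapF K c m2 U V)ᴴ = cxLapF K c m2 (fun b => (V b)ᴴ) (fun b => (U b)ᴴ) := by
  unfold cxLapF
  rw [conjTranspose_sub, cxHop_conjTranspose, diagonal_conjTranspose]
  congr 1
  ext p q
  simp only [diagonal_apply, Pi.star_apply, RCLike.star_def, RCLike.conj_ofReal]

omit hK [Fintype n] [DecidableEq n] in
/-- Public twin of the tree's private `placed_add`-type bookkeeping: `E_{xy}` is additive. [folklore] -/
theorem placed_add' (x y : Tor K) (A B : Matrix n n 𝕜) : placed x y (A + B) = placed x y A + placed x y B := by
  ext p q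
  simp only [placed, Matrix.of_apply, Matrix.add_apply]
  split_ifs <;> simp

omit hK [Fintype n] [DecidableEq n] in
/-- `E_{xy}` commutes with scalars. [folklore] -/
theorem placed_smul' (x y : Tor K) (a : 𝕜) (A : Matrix n n 𝕜) : placed x y (a • A) = a • placed x y A := by
  ext p q
  simp only [placed, Matrix.of_apply, Matrix.smul_apply, smul_eq_mul]
  split_ifs <;> simp

omit hK [Fintype n] [DecidableEq n] in
/-- `E_{xy}(0) = 0`. [folklore] -/
theorem placed_zero' (x y : Tor K) : placed x y (0 : Matrix n n 𝕜) = 0 := by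
  ext p q
  simp only [placed, Matrix.of_apply, Matrix.zero_apply]
  split_ifs <;> rfl

omit [Fintype n] [DecidableEq n] in
/-- LINEARITY (additivity) of the two-sided hopping matrix in the pair of link fields: `T_{U+U′,V+V′} = T_{U,V} + T_{U′,V′}`. [folklore] -/
theorem cxHop_add (c : ℝ) (U U' V V' : Tor K × Fin (d + 1) → Matrix n n 𝕜) :
    cxHop K c (U + U') (V + V') = cxHop K c U V + cxHop K c U' V' := by
  unfold cxHop
  rw [← Finset.sum_add_distrib]
  refine Finset.sum_congr rfl fun b _ => ?_
  rw [Pi.add_apply, Pi.add_apply, placed_add', placed_add', ← smul_add]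
  congr 1
  abel

omit [Fintype n] [DecidableEq n] in
/-- LINEARITY (homogeneity): `T_{aU,aV} = a·T_{U,V}` for every scalar `a : 𝕜`. [folklore] -/
theorem cxHop_smul (c : ℝ) (a : 𝕜) (U V : Tor K × Fin (d + 1) → Matrix n n 𝕜) :
    cxHop K c (a • U) (a • V) = a • cxHop K c U V := by
  unfold cxHop
  rw [Finset.smul_sum]
  refine Finset.sum_congr rfl fun b _ => ?_
  rw [Pi.smul_apply, Pi.smul_apply, placed_smul', placed_smul', ← smul_add, smul_comm]

omit [Fintype n] [DecidableEq n] in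
/-- `T_{0,0} = 0`. [folklore] -/
theorem cxHop_zero (c : ℝ) : cxHop K c (0 : Tor K × Fin (d + 1) → Matrix n n 𝕜) 0 = 0 := by
  unfold cxHop
  refine Finset.sum_eq_zero fun b _ => ?_
  rw [Pi.zero_apply, placed_zero', placed_zero', add_zero, smul_zero]

omit [Fintype n] [DecidableEq n] in
/-- `T_{U−U′,V−V′} = T_{U,V} − T_{U′,V′}`. [folklore] -/
theorem cxHop_sub (c : ℝ) (U U' V V' : Tor K × Fin (d + 1) → Matrix n n 𝕜) :
    cxHop K c (U - U') (V - V') = cxHop K c U V - cxHop K c U' V' := by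
  rw [eq_sub_iff_add_eq, ← cxHop_add, sub_add_cancel, sub_add_cancel]

omit [Fintype n] in
/-- THE SITE WEIGHTS CANCEL: `M_{U,V} − M_{U′,V′} = T_{U′,V′} − T_{U,V}` (the second resolvent identity of PART Ϛ-e starts here). [folklore] -/
theorem cxLapF_sub_cxLapF (c m2 : ℝ) (U U' V V' : Tor K × Fin (d + 1) → Matrix n n 𝕜) :
    cxLapF K c m2 U V - cxLapF K c m2 U' V' = cxHop K c U' V' - cxHop K c U V := by
  unfold cxLapF; abel

/-! ## §2 Blocks, entries and the stencil -/

omit hK [Fintype n] [DecidableEq n] in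
/-- Blocks of a sum (public twin of the tree's private `blk_add`). [folklore] -/
theorem blk_add' (M N : Matrix (Tor K × n) (Tor K × n) 𝕜) (x y : Tor K) : blk (M + N) x y = blk M x y + blk N x y := by
  ext i j; simp [blk]

omit hK [Fintype n] [DecidableEq n] in
/-- Blocks of a scalar multiple (public twin of the tree's private `blk_smul`). [folklore] -/
theorem blk_smul' (r : 𝕜) (M : Matrix (Tor K × n) (Tor K × n) 𝕜) (x y : Tor K) : blk (r • M) x y = r • blk M x y := by
  ext i j; simp [blk]

omit hK [Fintype n] [DecidableEq n] in
/-- Blocks of a finite sum (public twin of the tree's private `blk_sum`). [folklore] -/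
theorem blk_sum' {α : Type*} (s : Finset α) (M : α → Matrix (Tor K × n) (Tor K × n) 𝕜) (x y : Tor K) :
    blk (∑ a ∈ s, M a) x y = ∑ a ∈ s, blk (M a) x y := by
  ext i j
  simp only [blk, Matrix.of_apply, Matrix.sum_apply]

omit hK [Fintype n] [DecidableEq n] in
/-- Blocks of a placed matrix (public twin of the tree's private `blk_placed`): `(E_{xy}(A))_{x′y′} = [x = x′][y = y′]·A`. [folklore] -/
theorem blk_placed' (x y : Tor K) (A : Matrix n n 𝕜) (x' y' : Tor K) :
    blk (placed x y A) x' y' = if x = x' ∧ y = y' then A else 0 := by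
  ext i j
  simp only [blk, placed, Matrix.of_apply]
  split_ifs <;> rfl

omit [Fintype n] [DecidableEq n] in
/-- ★★ **THE BLOCKS OF THE TWO-SIDED HOPPING MATRIX**: `(T_{U,V})_{xy} = c·Σ_μ([y = x+e_μ]U(x,μ) + [y = x−e_μ]V(x−e_μ,μ))` (degenerate periods included: both brackets may hold).
[cite: Balaban1985BackgroundPropagators, (3.23) p.394, (3.50) p.400] -/
theorem blk_cxHop (c : ℝ) (U V : Tor K × Fin (d + 1) → Matrix n n 𝕜) (x y : Tor K) :
    blk (cxHop K c U V) x y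
      = (c : 𝕜) • ∑ μ, ((if y = x + unitVec K μ then U (x, μ) else 0) + (if y = x - unitVec K μ then V (x - unitVec K μ, μ) else 0)) := by
  unfold cxHop
  rw [blk_sum']
  simp only [blk_smul', blk_add', blk_placed']
  rw [← Finset.smul_sum, Fintype.sum_prod_type, Finset.sum_comm]
  congr 1
  refine Finset.sum_congr rfl fun μ _ => ?_
  rw [Finset.sum_add_distrib]
  congr 1
  · rw [Finset.sum_eq_single x (fun z _ hz => if_neg (fun h => hz h.1)) (fun hx => absurd (Finset.mem_univ _) hx)]
    simp only [true_and]
    exact if_congr eq_comm rfl rfl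
  · rw [Finset.sum_eq_single (x - unitVec K μ) (fun z _ hz => if_neg (fun h => hz (eq_sub_of_add_eq h.1)))
      (fun hx => absurd (Finset.mem_univ _) hx)]
    simp only [sub_add_cancel, true_and]
    exact if_congr eq_comm rfl rfl

omit hK [Fintype n] in
/-- The blocks of the diagonal site-weight matrix. [folklore] -/
theorem blk_diagonal_const (a : 𝕜) (x y : Tor K) :
    blk (diagonal (fun _ : Tor K × n => a)) x y = if x = y then a • (1 : Matrix n n 𝕜) else 0 := by
  ext i j
  simp only [blk, Matrix.of_apply, diagonal_apply, Prod.mk.injEq]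
  by_cases hxy : x = y
  · subst hxy; simp [Matrix.one_apply]
  · simp [hxy]

omit [Fintype n] in
/-- THE BLOCKS OF `M_{U,V}`: `(M_{U,V})_{xy} = [x = y](m²+2(d+1)c)·1 − (T_{U,V})_{xy}`. [cite: Balaban1985BackgroundPropagators, (3.23) p.394] -/
theorem blk_cxLapF (c m2 : ℝ) (U V : Tor K × Fin (d + 1) → Matrix n n 𝕜) (x y : Tor K) :
    blk (cxLapF K c m2 U V) x y
      = (if x = y then (((m2 + 2 * ((d : ℝ) + 1) * c : ℝ) : 𝕜) • (1 : Matrix n n 𝕜)) else 0)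
        - (c : 𝕜) • ∑ μ, ((if y = x + unitVec K μ then U (x, μ) else 0) + (if y = x - unitVec K μ then V (x - unitVec K μ, μ) else 0)) := by
  unfold cxLapF
  rw [blk_sub', blk_diagonal_const, blk_cxHop]

omit [Fintype n] in
/-- THE ENTRIES of `M_{U,V}`: `M_{U,V}((x,i),(y,j)) = (m²+2(d+1)c)[x=y][i=j] − cΣ_μ([y = x+e_μ]U(x,μ)_{ij} + [y = x−e_μ]V(x−e_μ,μ)_{ij})`.
[cite: Balaban1985BackgroundPropagators, (3.23) p.394; King1986, (4.4) p.670] -/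
theorem cxLapF_apply (c m2 : ℝ) (U V : Tor K × Fin (d + 1) → Matrix n n 𝕜) (x y : Tor K) (i j : n) :
    cxLapF K c m2 U V (x, i) (y, j)
      = (if x = y ∧ i = j then ((m2 + 2 * ((d : ℝ) + 1) * c : ℝ) : 𝕜) else 0)
        - (c : 𝕜) * ∑ μ, ((if y = x + unitVec K μ then U (x, μ) i j else 0)
            + (if y = x - unitVec K μ then V (x - unitVec K μ, μ) i j else 0)) := by
  have h := congr_fun (congr_fun (blk_cxLapF K c m2 U V x y) i) j
  rw [show cxLapF K c m2 U V (x, i) (y, j) = blk (cxLapF K c m2 U V) x y i j from rfl, h, Matrix.sub_apply, Matrix.smul_apply,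
    Matrix.sum_apply, smul_eq_mul]
  congr 1
  · by_cases hxy : x = y
    · simp only [hxy, true_and, if_true, Matrix.smul_apply, Matrix.one_apply, smul_eq_mul, mul_ite, mul_one, mul_zero]
    · simp only [hxy, false_and, if_false, Matrix.zero_apply]
  · congr 1
    refine Finset.sum_congr rfl fun μ _ => ?_
    rw [Matrix.add_apply]
    congr 1 <;> split_ifs <;> rfl

/-- ★★ **THE STENCIL**: `(M_{U,V}v)(x,i) = (m²+2(d+1)c)v(x,i) − cΣ_μ((U(x,μ)v(x+e_μ))_i + (V(x−e_μ,μ)v(x−e_μ))_i)` — the nearest-neighbour operator with INDEPENDENT forward and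
backward transporters ([B9] (3.50) with `R((U′U)_b)` on both orientations; King's (4.4) at `U = V ≡ 1`).
[cite: Balaban1985BackgroundPropagators, (3.50) p.400, (3.3) p.391, (3.23) p.394; King1986, (4.4) p.670] -/
theorem cxLapF_mulVec_apply (c m2 : ℝ) (U V : Tor K × Fin (d + 1) → Matrix n n 𝕜) (v : Tor K × n → 𝕜) (x : Tor K) (i : n) :
    (cxLapF K c m2 U V *ᵥ v) (x, i)
      = ((m2 + 2 * ((d : ℝ) + 1) * c : ℝ) : 𝕜) * v (x, i)
        - (c : 𝕜) * ∑ μ, ((U (x, μ) *ᵥ fun j => v (x + unitVec K μ, j)) i + (V (x - unitVec K μ, μ) *ᵥ fun j => v (x - unitVec K μ, j)) i) := by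
  unfold cxLapF
  rw [Matrix.sub_mulVec, Pi.sub_apply, mulVec_diagonal]
  congr 1
  unfold cxHop
  rw [Matrix.sum_mulVec, Finset.sum_apply, Fintype.sum_prod_type, Finset.sum_comm, Finset.mul_sum]
  refine Finset.sum_congr rfl fun μ _ => ?_
  simp only [Matrix.smul_mulVec, Matrix.add_mulVec, Pi.smul_apply, Pi.add_apply, smul_eq_mul]
  rw [← Finset.mul_sum, Finset.sum_add_distrib]
  congr 1
  congr 1
  · rw [Finset.sum_eq_single x (fun z _ hz => by rw [placed_mulVec_apply, if_neg hz]) (fun hx => absurd (Finset.mem_univ _) hx),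
      placed_mulVec_apply, if_pos rfl]
  · rw [Finset.sum_eq_single (x - unitVec K μ) (fun z _ hz => ?_) (fun hx => absurd (Finset.mem_univ _) hx),
      placed_mulVec_apply, if_pos (sub_add_cancel x (unitVec K μ))]
    rw [placed_mulVec_apply, if_neg]
    exact fun h => hz (eq_sub_of_add_eq h)

/-! ## §3 The `D₀`-factorisation and the telescoping identities (any `U, V`) -/

variable {c m2 : ℝ}

omit [Fintype n] in
/-- `M_{U,V} = D₀·(1 − D₀⁻¹T_{U,V})`, `D₀ = m² + 2(d+1)c > 0` (`c ≥ 0`, `m² > 0`). [cite: Balaban1985BackgroundPropagators, (3.23) p.394, p.398] -/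
theorem cxLapF_eq_smul (hc : 0 ≤ c) (hm : 0 < m2) (U V : Tor K × Fin (d + 1) → Matrix n n 𝕜) :
    cxLapF K c m2 U V = ((m2 + 2 * ((d : ℝ) + 1) * c : ℝ) : 𝕜) • (1 - (((m2 + 2 * ((d : ℝ) + 1) * c : ℝ) : 𝕜)⁻¹) • cxHop K c U V) := by
  have hD0 : (((m2 + 2 * ((d : ℝ) + 1) * c : ℝ) : 𝕜)) ≠ 0 := by
    rw [Ne, RCLike.ofReal_eq_zero]; exact (ne_of_gt (by positivity))
  unfold cxLapF
  rw [smul_sub, smul_smul, mul_inv_cancel₀ hD0, one_smul]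
  congr 1
  ext p q
  simp only [diagonal_apply, Matrix.smul_apply, Matrix.one_apply, smul_eq_mul, mul_ite, mul_one, mul_zero]

/-- ★ THE TELESCOPING IDENTITY (right): `M_{U,V}·Σ_{k<N}D₀^{−(k+1)}T_{U,V}^k = 1 − (D₀⁻¹T_{U,V})^N`, for EVERY pair of link fields.
[cite: Balaban1985BackgroundPropagators, p.398 l.26–27] -/
theorem cxLapF_mul_partialSum (hc : 0 ≤ c) (hm : 0 < m2) (U V : Tor K × Fin (d + 1) → Matrix n n 𝕜) (N : ℕ) :
    cxLapF K c m2 U V * ∑ k ∈ Finset.range N, ((((m2 + 2 * ((d : ℝ) + 1) * c : ℝ) : 𝕜)⁻¹) ^ (k + 1)) • cxHop K c U V ^ k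
      = 1 - ((((m2 + 2 * ((d : ℝ) + 1) * c : ℝ) : 𝕜)⁻¹) • cxHop K c U V) ^ N := by
  set D0 : 𝕜 := ((m2 + 2 * ((d : ℝ) + 1) * c : ℝ) : 𝕜) with hD0def
  have hD0 : D0 ≠ 0 := by rw [hD0def, Ne, RCLike.ofReal_eq_zero]; exact (ne_of_gt (by positivity))
  have hsum : ∑ k ∈ Finset.range N, (D0⁻¹ ^ (k + 1)) • cxHop K c U V ^ k = D0⁻¹ • ∑ k ∈ Finset.range N, (D0⁻¹ • cxHop K c U V) ^ k := by
    rw [Finset.smul_sum]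
    refine Finset.sum_congr rfl fun k _ => ?_
    rw [smul_pow, smul_smul, pow_succ', mul_comm]
  rw [cxLapF_eq_smul K hc hm U V, hsum, smul_mul_smul_comm, mul_inv_cancel₀ hD0, one_smul, mul_neg_geom_sum]

/-- ★ THE TELESCOPING IDENTITY (left): `Σ_{k<N}D₀^{−(k+1)}T_{U,V}^k·M_{U,V} = 1 − (D₀⁻¹T_{U,V})^N` — the partial sums commute with `M_{U,V}` (both are polynomials in `T_{U,V}`), so the
limit of PART Ϛ-b is a TWO-SIDED inverse without any Hermitian structure. [cite: Balaban1985BackgroundPropagators, p.398 l.26–27] -/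
theorem partialSum_mul_cxLapF (hc : 0 ≤ c) (hm : 0 < m2) (U V : Tor K × Fin (d + 1) → Matrix n n 𝕜) (N : ℕ) :
    (∑ k ∈ Finset.range N, ((((m2 + 2 * ((d : ℝ) + 1) * c : ℝ) : 𝕜)⁻¹) ^ (k + 1)) • cxHop K c U V ^ k) * cxLapF K c m2 U V
      = 1 - ((((m2 + 2 * ((d : ℝ) + 1) * c : ℝ) : 𝕜)⁻¹) • cxHop K c U V) ^ N := by
  set D0 : 𝕜 := ((m2 + 2 * ((d : ℝ) + 1) * c : ℝ) : 𝕜) with hD0def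
  have hD0 : D0 ≠ 0 := by rw [hD0def, Ne, RCLike.ofReal_eq_zero]; exact (ne_of_gt (by positivity))
  have hsum : ∑ k ∈ Finset.range N, (D0⁻¹ ^ (k + 1)) • cxHop K c U V ^ k = D0⁻¹ • ∑ k ∈ Finset.range N, (D0⁻¹ • cxHop K c U V) ^ k := by
    rw [Finset.smul_sum]
    refine Finset.sum_congr rfl fun k _ => ?_
    rw [smul_pow, smul_smul, pow_succ', mul_comm]
  rw [cxLapF_eq_smul K hc hm U V, hsum, smul_mul_smul_comm, inv_mul_cancel₀ hD0, one_smul, geom_sum_mul_neg]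

/-- `T_{U,V}` COMMUTES WITH `M_{U,V}`. [folklore] -/
theorem cxHop_mul_cxLapF_comm (c m2 : ℝ) (U V : Tor K × Fin (d + 1) → Matrix n n 𝕜) :
    cxHop K c U V * cxLapF K c m2 U V = cxLapF K c m2 U V * cxHop K c U V := by
  unfold cxLapF
  rw [Matrix.mul_sub, Matrix.sub_mul]
  congr 1
  ext p q
  simp only [Matrix.mul_diagonal, Matrix.diagonal_mul, mul_comm]

end Summit.QuantumFields.YangMills.BalabanUVNodes.N15KingModelRung.Covariant

end
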